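import Literature.MathematicalPhysics.QuantumFieldTheory.Balaban1983to89.Node00.OpsYCurlGrad
import Literature.MathematicalPhysics.QuantumFieldTheory.Balaban1983to89.Node00.OpsYDelta2Form
import Literature.MathematicalPhysics.QuantumFieldTheory.Balaban1983to89.B9Eq3104CommutatorSizesCurv
import Literature.MathematicalPhysics.QuantumFieldTheory.Balaban1983to89.B9PerturbationSplitAtLetters

/-!
# Bałaban 1985b (3.117) AT NODE 00's LETTERS: `Δ(U)D_Uλ = (i∕2)·[J(U), λ(b₋) + R(U(b))λ(b₊)]` — the Hessian on pure gauge modes IS the current commutator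

[B9] = Bałaban, *Propagators for lattice gauge theories in a background field*, CMP 99 (1985) 389–434, (3.117) p.419: *«Using gauge invariance of the
Wilson action we get `⟨D_Uλ, Δ(U)D_Uλ⟩ = ⟨J(U), i[λ₋, R(U)λ₊]⟩ …»* — the identity behind (3.118)–(3.121) (the error terms of the perturbation
split are small because the current `J` is).  This file proves it as an OPERATOR IDENTITY for def-Y's letters (`Node00/OpsYDeltaA`: `gradY` (3.3),
`curlY` (3.4), `coCurlY` (3.9), `jordanY`∕`curv2Y`∕`hessY` (3.10); `Node00/OpsYDelta2Form`: the current `JY` = r06's `B9Eq39Adjoint.J` (3.11) at the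
torus), for a general complete normed `ℂ`-algebra `𝔸` and every configuration `U` (no smallness, no unitarity):

* §1 `curlT_edgeY`, ★ `coCurlY_apply_eq_sum_edgeY` — the co-curl `D*_U` (3.9) in CONTOUR-TABLE form `c_f·Σ_{(p,m): b_m(p) = b} σ_m R(V_m)⁻¹F(p)`
  (the indexing native to `curv2Y`; table `b_m, σ_m, V_m` = `edgeY, sgnY, edgeParY` of (3.2));
* §2 ★★ `JY_eq_coCurlY` — **`J(U) = D*_U(c_f²·Im U(∂·))`**: print's (3.11) `J = D*η⁻²Im ∂U` literally, in def-Y's letters (`c_f = η⁻¹ > 0`), i.e. r06's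
  abstract current and def-Y's co-curl AGREE; `JY_eq_sum_edgeY` (contour-table form);
* §3 `primeEdgeY_gradY_telescope` — on a pure gauge mode `A = D_Uλ` the primed contour variables (3.2) TELESCOPE:
  `Σ_{l≻m}A′(b_l) − Σ_{l≺m}A′(b_l) = c_f·(Λ_z + R(U(∂p))⁻¹Λ_z − R(V_m)(λ(b_m₋) + R(U(b_m))λ(b_m₊)))`, `Λ_z = R(U_μ(x)U_ν(x+e_μ))λ(z)`;
  `edge_alg` — the one-plaquette algebra `½{c_f²(Λ_z − Λ_z′), Re U(∂p)} + ½i[S, c_f²Im U(∂p)] = (i∕2)c_f[c_f²Im U(∂p), N]` behind (3.117);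
* §4 ★★★ `hessY_gradY_eq_comm_JY`, `hessGradY_eq_comm_JY` — **(3.117)**: for `0 < c_f`,
  `(Δ(U)D_Uλ)(b) = (i∕2)·(J(U)(b)·M_b(λ) − M_b(λ)·J(U)(b))`, `M_b(λ) = λ(b₋) + R(U(b))λ(b₊)` — EXACTLY the displayed binder `hId` (with `κ₃ = i∕2`) of
  `B9Eq3117NormClausesFromIdentity` (dag-n06-w8), whence (3.118)'s two norm clauses.  Mechanism: `D_UD_Uλ = c_f²(R(U(∂p)) − 1)W`
  (`OpsYCurlGrad.curlY_gradY_eq_holY`) feeds the Jordan part, the telescoping §3 feeds the commutator part `Δ′₂`, and the two combine into the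
  `J`-commutator by `edge_alg` — every term of `Δ(U)D_Uλ` that is not proportional to `Im U(∂p)` cancels («gauge invariance of the Wilson action»).

All algebra is exact (no estimate of [B9] is asserted); count-neutral; N06 NOT discharged; one finite `𝕋^{d+1}` programme at fixed `ε` — nothing continuum,
nothing about OS or the mass gap ∕ Clay.  Cell `pub-ymgap` (HUMAN RULING D-0062), unit `pub-ymgap-node00-def-Y` (g23), 2026-08-28; referee ref-E ∕ ref-H.
-/

noncomputable section

namespace Literature.MathematicalPhysics.QuantumFieldTheory.Balaban1983to89.Node00.OpsYEq3117Identity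

open Node00
open Node00.OpsYNablaBridge (chartY shiftY_chartY shiftY_symm_chartY cdsS_apply shift_ne_self)
open Node00.OpsYCurlGrad (gradY_apply_mk curlY_gradY_apply)
open B9Eq3104CommutatorGradFormCurl (curlK_cast_smul extP_chartY coCurlY_apply_eq)
open B6GlobalChartV1 (PV boxEquiv)
open B6KLevelCensusIndexV1 (KIdx)
open B9Eq39Adjoint (R R_one R_add R_sub R_smul R_zero R_inv_R R_R_inv R_mul_R)
open B9BackgroundsKLevelV1 (shiftsV1)
open B9PerturbationSplitAtLetters (hessGradY)

variable {𝔸 : Type} [NormedRing 𝔸] [NormedAlgebra ℂ 𝔸] [CompleteSpace 𝔸]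
variable {d ℓ : ℕ} {hd : 1 ≤ d + 1} {hL : Odd (ℓ + 1) ∧ 1 < ℓ + 1} {b₀ b₁ : ℝ}
variable (i : KIdx d ℓ hd hL b₀ b₁)

/-! ## §1 The co-curl `D*_U` in contour-table form -/

/-- the curl's transporter on the `m`-th contour bond of `∂p` IS the table value `V_m ∈ {U(x,w), 1, 1, U(x,y)}` of (3.2).
[cite: Balaban1985BackgroundPropagators, (3.2) p.390, (3.4) p.391, bookkeeping] -/
theorem curlT_edgeY (U : CfgY 𝔸 i) (p : PlaqY i) (m : Fin 4) : curlT i U p (edgeY i p m) = edgeParY i U p m := by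
  have hμν : p.μ ≠ p.ν := ne_of_lt p.hμν
  have h1 : ¬ ((⟨p.src.shift p.ν, p.μ⟩ : FBondY i) = ⟨p.src.shift p.μ, p.ν⟩) := fun h => hμν (congrArg PBond.dir h)
  have h2 : ¬ ((⟨p.src, p.ν⟩ : FBondY i) = ⟨p.src.shift p.μ, p.ν⟩) :=
    fun h => shift_ne_self i p.src p.μ (congrArg PBond.src h).symm
  have h3 : ¬ ((⟨p.src, p.ν⟩ : FBondY i) = ⟨p.src.shift p.ν, p.μ⟩) :=
    fun h => shift_ne_self i p.src p.ν (congrArg PBond.src h).symm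
  have h4 : ¬ ((⟨p.src, p.μ⟩ : FBondY i) = ⟨p.src.shift p.μ, p.ν⟩) :=
    fun h => shift_ne_self i p.src p.μ (congrArg PBond.src h).symm
  have h5 : ¬ ((⟨p.src, p.μ⟩ : FBondY i) = ⟨p.src.shift p.ν, p.μ⟩) :=
    fun h => shift_ne_self i p.src p.ν (congrArg PBond.src h).symm
  fin_cases m
  · show curlT i U p ⟨p.src.shift p.ν, p.μ⟩ = U p.ν p.src
    simp only [curlT]; rw [if_neg h1, if_pos trivial]
  · show curlT i U p ⟨p.src, p.ν⟩ = 1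
    simp only [curlT]; rw [if_neg h2, if_neg h3]
  · show curlT i U p ⟨p.src, p.μ⟩ = 1
    simp only [curlT]; rw [if_neg h4, if_neg h5]
  · show curlT i U p ⟨p.src.shift p.μ, p.ν⟩ = U p.μ p.src
    simp only [curlT]; rw [if_pos trivial]

/-- ★ **THE CO-CURL `D*_U` (3.9) IN CONTOUR-TABLE FORM**: `(D*_U F)(b) = c_f·Σ_p Σ_{m : b_m(p) = b} σ_m·R(V_m)⁻¹F(p)` — the sum over the
plaquettes `p` whose contour contains `b` as its `m`-th bond, with the orientation sign `σ_m` and the inverted primed transporter `V_m` of (3.2)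
(the adjoint, for the trace pairing, of `(D_U A)(p) = c_f Σ_m σ_m R(V_m) A(b_m)`); the indexing native to def-Y's `Δ′₂ = curv2Y`.
[cite: Balaban1985BackgroundPropagators, (3.9) p.392, (3.2) p.390, (3.4) p.391] -/
theorem coCurlY_apply_eq_sum_edgeY (U : CfgY 𝔸 i) (F : PlaqY i → 𝔸) (f : FBondY i) :
    coCurlY i U F f = ((i.cf : ℝ) : ℂ) • ∑ p : PlaqY i, ∑ m : Fin 4,
      (if edgeY i p m = f then sgnY m • R (edgeParY i U p m)⁻¹ (F p) else 0) := by
  rw [coCurlY, trLiftY_apply]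
  simp_rw [cocurlK_eq_transpose, Matrix.transpose_apply, curlK_cast_smul]
  rw [← Finset.smul_sum]
  congr 1
  refine Finset.sum_congr rfl fun p _ => ?_
  -- under each constraint the transporter is the table value
  have key : ∀ b : FBondY i, (if b = f then R (curlT i U p f)⁻¹ (F p) else 0) = (if b = f then R (curlT i U p b)⁻¹ (F p) else 0) := by
    intro b
    split_ifs with h
    · rw [h]
    · rfl
  have t0 : curlT i U p ⟨p.src.shift p.ν, p.μ⟩ = U p.ν p.src := curlT_edgeY i U p 0
  have t1 : curlT i U p ⟨p.src, p.ν⟩ = 1 := curlT_edgeY i U p 1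
  have t2 : curlT i U p ⟨p.src, p.μ⟩ = 1 := curlT_edgeY i U p 2
  have t3 : curlT i U p ⟨p.src.shift p.μ, p.ν⟩ = U p.μ p.src := curlT_edgeY i U p 3
  have e0 : edgeY i p 0 = ⟨p.src.shift p.ν, p.μ⟩ := rfl
  have e1 : edgeY i p 1 = ⟨p.src, p.ν⟩ := rfl
  have e2 : edgeY i p 2 = ⟨p.src, p.μ⟩ := rfl
  have e3 : edgeY i p 3 = ⟨p.src.shift p.μ, p.ν⟩ := rfl
  have s0 : sgnY 0 = -1 := rfl
  have s1 : sgnY 1 = -1 := rfl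
  have s2 : sgnY 2 = 1 := rfl
  have s3 : sgnY 3 = 1 := rfl
  have v0 : edgeParY i U p 0 = U p.ν p.src := rfl
  have v1 : edgeParY i U p 1 = 1 := rfl
  have v2 : edgeParY i U p 2 = 1 := rfl
  have v3 : edgeParY i U p 3 = U p.μ p.src := rfl
  have hneg : ∀ (P : Prop) [Decidable P] (x : 𝔸), (if P then -x else 0) = -(if P then x else 0) := by
    intro P _ x
    split_ifs <;> simp
  simp only [key, Fin.sum_univ_four, e0, e1, e2, e3, s0, s1, s2, s3, v0, v1, v2, v3, t0, t1, t2, t3, inv_one, R_one, neg_smul, one_smul, hneg]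
  abel

/-! ## §2 The current `J(U) = D*_U(c_f²·Im U(∂·))` -/

/-- ★★ **(3.11) IN def-Y's LETTERS — `J(U) = D*_U(η⁻²Im ∂U)`**: for `0 < c_f` (so `η = |c_f|⁻¹ = c_f⁻¹`), r06's abstract lattice current at NODE 00's
torus (`JY`) IS def-Y's co-curl `coCurlY U` of the plaquette field `c_f²·Im U(∂p)`; the two independent typings of `D*` (r06's `divP` by direction
pairs, def-Y's transported lift of the transposed curl kernel) agree. [cite: Balaban1985BackgroundPropagators, (3.11) p.392, (3.9) p.392, (3.117) p.419] -/
theorem JY_eq_coCurlY (hcf : 0 < i.cf) (U : CfgY 𝔸 i) :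
    JY i U = coCurlY i U (fun p => ((i.cf ^ 2 : ℝ) : ℂ) • imHolY i U p) := by
  funext b
  obtain ⟨y, κ⟩ := b
  have hη : ((etaBY i : ℝ) : ℂ)⁻¹ = ((i.cf : ℝ) : ℂ) := by
    rw [← Complex.ofReal_inv, etaBY, inv_inv, abs_of_pos hcf]
  have e2 : ∀ (μ : Fin (d + 1)) (x : Site (PV d ℓ i.m i.K hd hL) 0), (shiftsV1 (PV d ℓ i.m i.K hd hL) μ).symm x = x.unshift μ :=
    fun _ _ => rfl
  have him : ∀ (x : Site (PV d ℓ i.m i.K hd hL) 0) (a c : Fin (d + 1)) (h : a < c),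
      imHolY i U ⟨x, a, c, h⟩ = B9Eq37Insertion.imC (B9Eq39Adjoint.plaqU (shiftsV1 (PV d ℓ i.m i.K hd hL)) U a c x) := by
    intro x a c h
    rw [imHolY, B9Eq37Insertion.imC_eq, neg_div]
    rfl
  rw [JY_apply, coCurlY_apply_eq]
  simp only [B9Eq39Adjoint.J, B9Eq39Adjoint.divPη, B9Eq39Adjoint.divP, B9Eq39Adjoint.covDstar, hη, ← Finset.sum_sub_distrib]
  congr 1
  refine Finset.sum_congr rfl fun μ _ => ?_
  simp only [cdsS_apply, shiftY_symm_chartY, Equiv.symm_apply_apply, extP_chartY, e2]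
  by_cases h1 : μ < κ
  · have h2 : ¬ κ < μ := lt_asymm h1
    simp [h1, h2, him, R_zero]
  · by_cases h2 : κ < μ
    · simp [h1, h2, him, R_zero]
    · simp [h1, h2]

/-- **`J(U)` in contour-table form**: `J(U)(b) = c_f·Σ_p Σ_{m : b_m(p) = b} σ_m R(V_m)⁻¹(c_f²·Im U(∂p))` (`0 < c_f`).
[cite: Balaban1985BackgroundPropagators, (3.11) p.392, (3.9) p.392] -/
theorem JY_eq_sum_edgeY (hcf : 0 < i.cf) (U : CfgY 𝔸 i) (f : FBondY i) :
    JY i U f = ((i.cf : ℝ) : ℂ) • ∑ p : PlaqY i, ∑ m : Fin 4,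
      (if edgeY i p m = f then sgnY m • R (edgeParY i U p m)⁻¹ (((i.cf ^ 2 : ℝ) : ℂ) • imHolY i U p) else 0) := by
  rw [JY_eq_coCurlY i hcf, coCurlY_apply_eq_sum_edgeY]

/-! ## §3 The contour telescoping on pure gauge modes, and the one-plaquette algebra -/

/-- **THE PRIMED CONTOUR VARIABLES OF A PURE GAUGE MODE TELESCOPE**: for `A = D_Uλ`, `p = p_{μν}(x)` and each `m`,
`Σ_{l≻m}A′(b_l) − Σ_{l≺m}A′(b_l) = c_f·(Λ_z + R(U(∂p))⁻¹Λ_z − R(V_m)(λ(b_m₋) + R(U(b_m))λ(b_m₊)))` with `Λ_z = R(U_μ(x)U_ν(x+e_μ))λ̂(z)` the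
far corner transported along `x → y → z` and `R(U(∂p))⁻¹Λ_z = R(U_ν(x)U_μ(x+e_ν))λ̂(z)` the same corner along `x → w → z`: in the `x`-frame the
four primed differences are `c_f·(Λ_y − Λ_x), c_f·(Λ_z − Λ_y), −c_f·(Λ_z′ − Λ_w), −c_f·(Λ_w − Λ_x)` and the signed partial sums collapse.
[cite: Balaban1985BackgroundPropagators, (3.2) p.390, (3.3) p.390, (3.117) p.419] -/
theorem primeEdgeY_gradY_telescope (U : CfgY 𝔸 i) (Λ : SiteY i → 𝔸) (p : PlaqY i) (m : Fin 4) :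
    (∑ l : Fin 4, (if m < l then primeEdgeY i U p l else 0)) (gradY i U Λ)
        - (∑ l : Fin 4, (if l < m then primeEdgeY i U p l else 0)) (gradY i U Λ)
      = ((i.cf : ℝ) : ℂ) •
          (R (U p.μ p.src * U p.ν (p.src.shift p.μ)) (Λ (chartY i ((p.src.shift p.μ).shift p.ν)))
            + R (holY i U p)⁻¹ (R (U p.μ p.src * U p.ν (p.src.shift p.μ)) (Λ (chartY i ((p.src.shift p.μ).shift p.ν))))
            - R (edgeParY i U p m)
                (Λ (chartY i (edgeY i p m).src) + R (U (edgeY i p m).dir (edgeY i p m).src) (Λ (chartY i (edgeY i p m).tgt)))) := by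
  have hcomm : (p.src.shift p.ν).shift p.μ = (p.src.shift p.μ).shift p.ν := B5Local114G0Second.shift_shift_comm p.src p.ν p.μ
  have hX : R (holY i U p)⁻¹ (R (U p.μ p.src * U p.ν (p.src.shift p.μ)) (Λ (chartY i ((p.src.shift p.μ).shift p.ν))))
      = R (U p.ν p.src * U p.μ (p.src.shift p.ν)) (Λ (chartY i ((p.src.shift p.μ).shift p.ν))) := by
    rw [← B9Eq39Adjoint.R_mul, holY]
    congr 1
    group
  rw [hX]
  -- the contour table (3.2), rows `m = 0, 1, 2, 3` (both spellings of the row index)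
  have e0 : edgeY i p 0 = ⟨p.src.shift p.ν, p.μ⟩ := rfl
  have e1 : edgeY i p 1 = ⟨p.src, p.ν⟩ := rfl
  have e2 : edgeY i p 2 = ⟨p.src, p.μ⟩ := rfl
  have e3 : edgeY i p 3 = ⟨p.src.shift p.μ, p.ν⟩ := rfl
  have e0' : ∀ h, edgeY i p ⟨0, h⟩ = ⟨p.src.shift p.ν, p.μ⟩ := fun _ => rfl
  have e1' : ∀ h, edgeY i p ⟨1, h⟩ = ⟨p.src, p.ν⟩ := fun _ => rfl
  have e2' : ∀ h, edgeY i p ⟨2, h⟩ = ⟨p.src, p.μ⟩ := fun _ => rfl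
  have e3' : ∀ h, edgeY i p ⟨3, h⟩ = ⟨p.src.shift p.μ, p.ν⟩ := fun _ => rfl
  have s0 : sgnY 0 = -1 := rfl
  have s1 : sgnY 1 = -1 := rfl
  have s2 : sgnY 2 = 1 := rfl
  have s3 : sgnY 3 = 1 := rfl
  have v0 : edgeParY i U p 0 = U p.ν p.src := rfl
  have v1 : edgeParY i U p 1 = 1 := rfl
  have v2 : edgeParY i U p 2 = 1 := rfl
  have v3 : edgeParY i U p 3 = U p.μ p.src := rfl
  have v0' : ∀ h, edgeParY i U p ⟨0, h⟩ = U p.ν p.src := fun _ => rfl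
  have v1' : ∀ h, edgeParY i U p ⟨1, h⟩ = 1 := fun _ => rfl
  have v2' : ∀ h, edgeParY i U p ⟨2, h⟩ = 1 := fun _ => rfl
  have v3' : ∀ h, edgeParY i U p ⟨3, h⟩ = U p.μ p.src := fun _ => rfl
  fin_cases m <;>
  · simp (config := { decide := true }) only [Fin.isValue, Fin.sum_univ_four, if_true, if_false, LinearMap.add_apply,
      LinearMap.zero_apply, zero_add, add_zero, sub_zero, zero_sub, B13OpsYPencilHessian.primeEdgeY_apply,
      e0, e1, e2, e3, e0', e1', e2', e3', s0, s1, s2, s3, v0, v1, v2, v3, v0', v1', v2', v3', gradY_apply_mk, PBond.tgt, hcomm,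
      R_smul, R_add, R_sub, ← B9Eq39Adjoint.R_mul, R_one, one_mul, one_smul, neg_smul, smul_add, smul_sub]
    module

/-- **THE ONE-PLAQUETTE ALGEBRA BEHIND (3.117)**: with `h = U(∂p)`, `Re = ½(h + h⁻¹)`, `Im = (2i)⁻¹(h − h⁻¹)`, `X′ = R(h)⁻¹X` and
`S = c·(X + X′ − R(V)M)`:  `c·σR(V)⁻¹½{c₂(X − X′), Re} + ½·σR(V)⁻¹ i[S, c₂Im] = (i∕2)·[c·σR(V)⁻¹(c₂Im), M]` — the `Re`-anticommutator of the
holonomy defect `X − X′` and the `Im`-commutator of `X + X′` cancel identically (only `hh⁻¹ = 1` is used), leaving the `Im`-commutator of the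
contour letter `N = R(V)M`. [cite: Balaban1985BackgroundPropagators, (3.117) p.419 («using gauge invariance of the Wilson action»), (3.7) p.391] -/
theorem edge_alg (c c₂ σ : ℂ) (U : CfgY 𝔸 i) (p : PlaqY i) (V : 𝔸ˣ) (X M S : 𝔸)
    (hS : S = c • (X + R (holY i U p)⁻¹ X - R V M)) :
    c • (σ • R V⁻¹ ((1 / 2 : ℂ) • ((c₂ • (X - R (holY i U p)⁻¹ X)) * reHolY i U p
        + reHolY i U p * (c₂ • (X - R (holY i U p)⁻¹ X)))))
      + (1 / 2 : ℂ) • (σ • R V⁻¹ (Complex.I • (S * (c₂ • imHolY i U p) - (c₂ • imHolY i U p) * S)))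
      = (Complex.I / 2) • ((c • (σ • R V⁻¹ (c₂ • imHolY i U p))) * M - M * (c • (σ • R V⁻¹ (c₂ • imHolY i U p)))) := by
  subst hS
  simp only [B9Eq39Adjoint.R, reHolY, imHolY, inv_inv]
  simp only [smul_add, smul_sub, mul_add, add_mul, mul_sub, sub_mul, smul_mul_assoc, mul_smul_comm, ← mul_assoc,
    Units.mul_inv_cancel_right, Units.inv_mul_cancel_right, Units.mul_inv, Units.inv_mul, one_mul, smul_smul]
  match_scalars <;> (ring_nf; try simp only [Complex.I_sq]; try ring_nf)

/-! ## §4 ★★★ (3.117): `Δ(U)D_Uλ` is the commutator with the current -/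

/-- ★★★ **(3.117) — THE HESSIAN ON PURE GAUGE MODES IS THE CURRENT COMMUTATOR**: for `0 < c_f` (`= η⁻¹`), every configuration `U`, every `λ`
and every bond `b = ⟨s, s+e_κ⟩`,
`(Δ(U)D_Uλ)(b) = (i∕2)·(J(U)(b)·M_b(λ) − M_b(λ)·J(U)(b))`, `M_b(λ) = λ̂(s) + R(U_κ(s))λ̂(s+e_κ)` (`λ̂ = λ ∘ chart`):
print's `⟨D_Uλ, Δ(U)D_Uλ⟩ = ⟨J(U), i[λ₋, R(U)λ₊]⟩` before pairing, with the constant `κ₃ = i∕2` of its normalisation (`½` from the Jordan∕commutator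
polarisation of (3.10), `i` from `Im`).  In particular `Δ(U)D_U = 0` wherever the current vanishes (flat `U`: `J = 0`).
[cite: Balaban1985BackgroundPropagators, (3.117) p.419, (3.10)–(3.11) p.392, (3.7) p.391] -/
theorem hessY_gradY_eq_comm_JY (hcf : 0 < i.cf) (U : CfgY 𝔸 i) (Λ : SiteY i → 𝔸) (f : FBondY i) :
    hessY i U (gradY i U Λ) f
      = (Complex.I / 2) • (JY i U f * (Λ (chartY i f.src) + R (U f.dir f.src) (Λ (chartY i f.tgt)))
          - (Λ (chartY i f.src) + R (U f.dir f.src) (Λ (chartY i f.tgt))) * JY i U f) := by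
  rw [JY_eq_sum_edgeY i hcf]
  simp only [hessY, LinearMap.add_apply, LinearMap.comp_apply, Pi.add_apply]
  rw [coCurlY_apply_eq_sum_edgeY, B9Eq3104CommutatorSizesCurv.curv2Y_apply]
  simp only [Finset.smul_sum, Finset.sum_mul, Finset.mul_sum, ← Finset.sum_sub_distrib, ← Finset.sum_add_distrib]
  refine Finset.sum_congr rfl fun p _ => Finset.sum_congr rfl fun m _ => ?_
  split_ifs with h
  · subst h
    have hX : R (U p.ν p.src * U p.μ (p.src.shift p.ν)) (Λ (chartY i ((p.src.shift p.μ).shift p.ν)))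
        = R (holY i U p)⁻¹ (R (U p.μ p.src * U p.ν (p.src.shift p.μ)) (Λ (chartY i ((p.src.shift p.μ).shift p.ν)))) := by
      rw [← B9Eq39Adjoint.R_mul, holY]
      congr 1
      group
    simp only [jordanY, commY, LinearMap.smul_apply, Pi.smul_apply, LinearMap.pi_apply, LinearMap.comp_apply, LinearMap.proj_apply,
      LinearMap.add_apply, LinearMap.sub_apply, LinearMap.mulRight_apply, LinearMap.mulLeft_apply, curlY_gradY_apply, hX]
    exact edge_alg i _ _ _ U p _ _ _ _ (primeEdgeY_gradY_telescope i U Λ p m)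
  · simp

/-- ★★★ **(3.117) FOR `B(U) = Δ(U)∘D_U`** (`B9PerturbationSplitAtLetters.hessGradY`, the current term of the perturbation split (3.120)):
`(B(U)λ)(b) = (i∕2)·(J(U)(b)·M_b(λ) − M_b(λ)·J(U)(b))`, `M_b` spelled on the box chart `boxEquiv i.hN` (= `chartY i`) — verbatim the displayed
identity `hId` (with `κ₃ := i∕2`) from which
`B9Eq3117NormClausesFromIdentity` derives the two norm clauses `‖B(U)λ‖ ≲ ‖J‖(‖λ‖ + ‖∇_Uλ‖)` of (3.118).
[cite: Balaban1985BackgroundPropagators, (3.117)–(3.118) p.419, (3.120) p.419] -/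
theorem hessGradY_eq_comm_JY (hcf : 0 < i.cf) (U : CfgY 𝔸 i) (Λ : SiteY i → 𝔸) (f : FBondY i) :
    hessGradY i U Λ f
      = (Complex.I / 2) • (JY i U f * (Λ (boxEquiv i.hN f.src) + R (U f.dir f.src) (Λ (boxEquiv i.hN f.tgt)))
          - (Λ (boxEquiv i.hN f.src) + R (U f.dir f.src) (Λ (boxEquiv i.hN f.tgt))) * JY i U f) :=
  hessY_gradY_eq_comm_JY i hcf U Λ f

/-- **(3.117) ⇒ `B(U) = 0` AT A CURRENT-FREE CONFIGURATION** (e.g. flat `U`): `J(U) = 0 ⇒ Δ(U)∘D_U = 0` — the Hessian of the Wilson action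
annihilates pure gauge modes exactly when the background is on shell. [cite: Balaban1985BackgroundPropagators, (3.117) p.419, (3.36) p.398] -/
theorem hessGradY_eq_zero_of_JY_eq_zero (hcf : 0 < i.cf) {U : CfgY 𝔸 i} (hJ : JY i U = 0) : hessGradY i U = 0 := by
  refine LinearMap.ext fun Λ => funext fun f => ?_
  rw [hessGradY_eq_comm_JY i hcf, hJ, Pi.zero_apply, zero_mul, mul_zero, sub_self, smul_zero, LinearMap.zero_apply, Pi.zero_apply]

end Literature.MathematicalPhysics.QuantumFieldTheory.Balaban1983to89.Node00.OpsYEq3117Identity
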